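import Summits.BirchSwinnertonDyer.Rank1Residual.X4.KuriharaLevelLoweringModPow
import Summits.BirchSwinnertonDyer.Rank1Residual.X4.KimDefectLevelLoweringRankOne
import HarnessLib

/-!
# Rank ONE under a mod-`p^e` level-lowering certificate: `∂^{(∞)}(δ̃) ≥ e` (file `X4/KuriharaLevelLoweringModPow.lean`) plus ONE Kurihara number `≢ 0 (mod p^{e+1})` closes `Ш(E/ℚ)[p^∞] = 0` WITHOUT Cassels–Tate (cell `b2b-bsdres`, seat additive-p4 gen 29, line V49; CLASS-CLOSURE O7 ∩ X4 Tamagawa rows; the rank-one companion of `X4/KimDefectLevelLoweringModPow.lean`)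

HONEST FRAMING (cell `b2b-bsdres`, verbatim in every file): the goal of the cell is to DELETE the
COMBINATION-SHAPED residual classes for ALL analytic-rank `≤ 1` curves over `ℚ` — "full BSD formula for
every rank `≤ 1` curve in class `C`" assembled STRICTLY from published theorems — so that the rank-`≤ 1`
remainder becomes exactly the CONSTRUCTION-SHAPED classes, which are TYPED (missing-input Props), NOT
attempted; this is not "finishing BSD". This file: research route on the CONSTRUCTION-shaped class X4
(additive `p`, `E[p]` irreducible); X4 stays CONSTRUCTION-SHAPED; labels unchanged; nothing booked; no
Literature fact minted; the `p = 3` statement is CONDITIONAL on the cell's conjecture `X4SharpThreeKimRankOnePartial` (p17;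
printed reason Kim 2025 Thm. 1.1 (Str), PREPRINT); THEOREMS ONLY; `#print axioms` standard.

## What is here

Gen 22 (`X4/KimDefectLevelLoweringRankOne.lean`) closed, per pair and from ONE finite mod-`p` certificate
`PlusSymbolLevelLowersAt W p D.f ℓ` (`∂^{(∞)} ≥ 1`), the rank-one Tamagawa rows given one Kurihara number
`≢ 0 (mod p²)` (CT-free) or `≢ 0 (mod p³)` (with Cassels–Tate). The sibling `X4/KuriharaLevelLoweringModPow.lean` proves the EXPONENT form: the
mod-`p^e` certificate `PlusSymbolLevelLowersModAt W p D.f (p^e) ℓ` gives **`∂^{(∞)}(δ̃) ≥ e`**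
(`le_kuriharaPartialInfty_of_plusSymbolLevelLowersModAt`). This file draws the consequences, with
`α = e` in the cell's sockets:

* §1 (rank ONE, any `p`, the rank-one `∂`-clause `hK` explicit; then `p ≥ 5` with `hK` DISCHARGED by
  E73): the certificate and ONE `δ̃_ℓ ≢ 0 (mod p^{e+1})` at a cyclic Kolyvagin prime `ℓ ∈ 𝒫_{e+1}`
  give `ord_p #Ш(E/ℚ)(p) + e ≤ (e + 1) − 1`, i.e. `#Ш(E/ℚ)(p) = 1` WITHOUT Cassels–Tate (gen 22's
  level-THREE route for `ord_p c_{ℓ₀} = 2` needed Cassels–Tate), and `BSD(E,p)` with `#Ш_an` a `p`-unit;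
  at level `e + 2` WITH Cassels–Tate (`ord_p #Ш ≤ 1` + squareness) the rows with ONE further unit of `p`
  in `∏_v c_v` close as well; in general `ord_p #Ш(E/ℚ)(p) ≤ k − 1 − e` from one `δ̃_ℓ ≢ 0 (mod p^k)`.
* §2 (`p = 3`): the same MODULO the cell's conjecture `X4SharpThreeKimRankOnePartial`.
(The analytic-rank-`0` consequences are the sibling `X4/KimDefectLevelLoweringModPow.lean`.)

WHERE IT BITES (E2 anatomy; numbers of record, nothing booked): the O7 ∩ X4 Tamagawa rows whose whole
`p`-defect sits at ONE split prime `ℓ₀` with `ord_p c_{ℓ₀} = e` (level `e + 1`, CT-free; V43 census at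
`p = 3`: 38 of the 7 903 `r1-TAM` rows with `ord₃ ∏ c ≥ 2`) or there plus ONE unit elsewhere (level `e + 2`
+ CT: 5 999 of them, the bulk); per pair, from a
FINITE mod-`p^e` certificate (two modular-symbol lattices mod `p^e`; instrument E4/E5 at modulus
`p^e`, gen 27 batch X: `e_max = ord_p c_ℓ` on 4/4). Rows whose defect is spread over several primes
each with `ord_p c = 1` are NOT reached by a single-prime certificate (the product structure
`(1 − σ_{ℓ₁}^{-1})(1 − σ_{ℓ₂}^{-1})` is depth in the augmentation filtration, not `p`-divisibility).
The certificate is EVIDENCE computed per row, never a fact (Dahmen–Yazdani 2012 Thm. 2, the printed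
mod-`l^r` level lowering, assumes `l² ∤ N` — unavailable on X4).

References: Kim 2026 [Kim2022StructureSelmer] Thm. 1.9 (6), §1.5.1, Conj. 1.10; Kim 2025
[Kim2025RefinedTNC] Thm. 1.1 (PREPRINT, reason only); Silverman AEC X.4.14 [SilvermanAEC2009]; Miller
2011 [Miller2011LMS] Def. 1.1; Cremona 1997 [CremonaAlgorithms1997] §2.8; Dahmen–Yazdani 2012
[DahmenYazdani2012] Thm. 2 (why the certificate is expected; not an input).
-/

noncomputable section

open scoped Classical MatrixGroups ModularForm

open CongruenceSubgroup WeierstrassCurve Literature.NumberTheory.EllipticCurves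
  Literature.NumberTheory.EllipticCurves.ModularForms
  Literature.NumberTheory.EllipticCurves.Rank1Residual
  Literature.NumberTheory.EllipticCurves.Rank1Residual.Typed
  Summit.BirchSwinnertonDyer.Rank1Residual.LevelLowering
  Summit.BirchSwinnertonDyer.Rank1Residual.Additive

namespace Summit.BirchSwinnertonDyer.Rank1Residual.X4

variable (W : WeierstrassCurve ℚ) [W.IsElliptic] [W.IsGloballyMinimal] (p : ℕ) [Fact p.Prime]

/-! ### §1 Rank ONE: the mod-`p^e` certificate plus ONE Kurihara number `≢ 0 (mod p^{e+1})` -/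

section RankOne

/-- **`ord_p #Ш(E/ℚ)(p) + e ≤ k − 1`** from the rank-one `∂`-clause `hK`, the mod-`p^e` certificate
(`∂^{(∞)} ≥ e`) and ONE `δ̃_ℓ ≢ 0 (mod p^k)` at a cyclic Kolyvagin prime `ℓ ∈ 𝒫_k` (`∂^{(1)} ≤ k − 1`)
— gen 22's shape with `α = e`. ANY reduction at `p`; `hK` explicit; per pair.
[cite: Kim2022StructureSelmer, Thm. 1.9 (6) and §1.5.1 (PDF pp. 7–8)] -/
theorem padicValNat_primaryComponent_add_le_of_partial_of_plusSymbolLevelLowersModAt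
    (hK : KimRankOnePartialAt W p) (hp2 : p ≠ 2)
    (hsurj : W.HasSurjectiveModNGaloisRep p)
    (htower : ∀ n : ℕ, W.HasSurjectiveModNGaloisRep (p ^ n : ℕ)) (hL : W.entireLFunction 1 = 0)
    (hr : W.analyticRank = 1) (hfin : Finite W.sha)
    {N : ℕ} [NeZero N] (D : ModularParametrizationData W N) (hN : W.conductorNorm ℤ = N)
    (hc : ¬ (p : ℤ) ∣ D.maninConstant)
    (hper : ∃ u : ℚ, ‖(u : ℚ_[p])‖ = 1 ∧ W.realPeriodRat = u * plusPeriod D.f)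
    {e ℓ₀ : ℕ} (hcert : PlusSymbolLevelLowersModAt W p D.f (p ^ e) ℓ₀) (hℓ₀ : ℓ₀ ∣ W.conductorNorm ℤ)
    {k : ℕ} (hk : 1 ≤ k) (ℓ : ℕ) [Fact ℓ.Prime] (hℓ : Kato.IsKolyvaginPrime W p k ℓ)
    (hcyc : Nat.card {P : ((WeierstrassCurve.integralModelInt W).map
        (Int.castRingHom (ZMod ℓ))).toAffine.Point // p • P = 0} ≤ p)
    (ψ : (ℓ' : ℕ) → (ZMod ℓ')ˣ →* Multiplicative (ZMod (p ^ k)))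
    (hψ : Function.Surjective (ψ ℓ)) (hδ : kuriharaNumber D.f (p ^ k) ℓ ψ ≠ 0) :
    padicValNat p (Nat.card (AddCommGroup.primaryComponent W.sha p)) + e ≤ k - 1 := by
  have hirr := hasIrreducibleModPGaloisRep_of_hasSurjectiveModNGaloisRep W p hsurj
  have he : ((e : ℕ) : ℕ∞) ≤ kuriharaPartialInfty W p D.f :=
    le_kuriharaPartialInfty_of_plusSymbolLevelLowersModAt hp2 hirr D hN hcert hℓ₀
  exact padicValNat_primaryComponent_add_le_of_partial_of_le_partialInfty W p hK hsurj htower hL hr hfin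
    D hc hper he hk ℓ hℓ hcyc ψ hψ hδ

/-- **`ord_p #Ш(E/ℚ)(p) = 0` from the rank-one `∂`-clause `hK`, the mod-`p^e` certificate and ONE
`δ̃_ℓ ≢ 0 (mod p^{e+1})`** at a cyclic Kolyvagin prime `ℓ ∈ 𝒫_{e+1}`: `length + ∂^{(∞)} = ∂^{(1)}
≤ (e + 1) − 1` with `∂^{(∞)} ≥ e`. ANY reduction at `p`; `hK` explicit; per pair; NO Cassels–Tate.
[cite: Kim2022StructureSelmer, Thm. 1.9 (6) and §1.5.1 (PDF pp. 7–8)] -/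
theorem padicValNat_primaryComponent_eq_zero_of_partial_of_plusSymbolLevelLowersModAt_levelSucc
    (hK : KimRankOnePartialAt W p) (hp2 : p ≠ 2)
    (hsurj : W.HasSurjectiveModNGaloisRep p)
    (htower : ∀ n : ℕ, W.HasSurjectiveModNGaloisRep (p ^ n : ℕ)) (hL : W.entireLFunction 1 = 0)
    (hr : W.analyticRank = 1) (hfin : Finite W.sha)
    {N : ℕ} [NeZero N] (D : ModularParametrizationData W N) (hN : W.conductorNorm ℤ = N)
    (hc : ¬ (p : ℤ) ∣ D.maninConstant)
    (hper : ∃ u : ℚ, ‖(u : ℚ_[p])‖ = 1 ∧ W.realPeriodRat = u * plusPeriod D.f)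
    {e ℓ₀ : ℕ} (hcert : PlusSymbolLevelLowersModAt W p D.f (p ^ e) ℓ₀) (hℓ₀ : ℓ₀ ∣ W.conductorNorm ℤ)
    (ℓ : ℕ) [Fact ℓ.Prime] (hℓ : Kato.IsKolyvaginPrime W p (e + 1) ℓ)
    (hcyc : Nat.card {P : ((WeierstrassCurve.integralModelInt W).map
        (Int.castRingHom (ZMod ℓ))).toAffine.Point // p • P = 0} ≤ p)
    (ψ : (ℓ' : ℕ) → (ZMod ℓ')ˣ →* Multiplicative (ZMod (p ^ (e + 1))))
    (hψ : Function.Surjective (ψ ℓ)) (hδ : kuriharaNumber D.f (p ^ (e + 1)) ℓ ψ ≠ 0) :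
    padicValNat p (Nat.card (AddCommGroup.primaryComponent W.sha p)) = 0 := by
  have hirr := hasIrreducibleModPGaloisRep_of_hasSurjectiveModNGaloisRep W p hsurj
  have he : ((e : ℕ) : ℕ∞) ≤ kuriharaPartialInfty W p D.f :=
    le_kuriharaPartialInfty_of_plusSymbolLevelLowersModAt hp2 hirr D hN hcert hℓ₀
  have h := padicValNat_primaryComponent_add_le_of_partial_of_le_partialInfty W p hK hsurj htower hL
    hr hfin D hc hper he (by omega) ℓ hℓ hcyc ψ hψ hδ
  omega

/-- **Level `e + 1` closes the row, Cassels–Tate-free**: under the mod-`p^e` certificate, ONE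
`δ̃_ℓ ≢ 0 (mod p^{e+1})` at a cyclic `ℓ ∈ 𝒫_{e+1}` gives `#Ш(E/ℚ)(p) = 1`. Rank one, `hK` explicit;
ANY reduction at `p`; per pair. [cite: Kim2022StructureSelmer, Thm. 1.9 (6) and §1.5.1 (PDF pp. 7–8)] -/
theorem card_primaryComponent_eq_one_of_partial_of_plusSymbolLevelLowersModAt_levelSucc
    (hK : KimRankOnePartialAt W p) (hp2 : p ≠ 2)
    (hsurj : W.HasSurjectiveModNGaloisRep p)
    (htower : ∀ n : ℕ, W.HasSurjectiveModNGaloisRep (p ^ n : ℕ)) (hL : W.entireLFunction 1 = 0)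
    (hr : W.analyticRank = 1) (hfin : Finite W.sha)
    {N : ℕ} [NeZero N] (D : ModularParametrizationData W N) (hN : W.conductorNorm ℤ = N)
    (hc : ¬ (p : ℤ) ∣ D.maninConstant)
    (hper : ∃ u : ℚ, ‖(u : ℚ_[p])‖ = 1 ∧ W.realPeriodRat = u * plusPeriod D.f)
    {e ℓ₀ : ℕ} (hcert : PlusSymbolLevelLowersModAt W p D.f (p ^ e) ℓ₀) (hℓ₀ : ℓ₀ ∣ W.conductorNorm ℤ)
    (ℓ : ℕ) [Fact ℓ.Prime] (hℓ : Kato.IsKolyvaginPrime W p (e + 1) ℓ)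
    (hcyc : Nat.card {P : ((WeierstrassCurve.integralModelInt W).map
        (Int.castRingHom (ZMod ℓ))).toAffine.Point // p • P = 0} ≤ p)
    (ψ : (ℓ' : ℕ) → (ZMod ℓ')ˣ →* Multiplicative (ZMod (p ^ (e + 1))))
    (hψ : Function.Surjective (ψ ℓ)) (hδ : kuriharaNumber D.f (p ^ (e + 1)) ℓ ψ ≠ 0) :
    Nat.card (AddCommGroup.primaryComponent W.sha p) = 1 := by
  haveI : Finite W.sha := hfin
  exact card_primaryComponent_eq_one_of_padicValNat_eq_zero W p
    (padicValNat_primaryComponent_eq_zero_of_partial_of_plusSymbolLevelLowersModAt_levelSucc W p hK hp2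
      hsurj htower hL hr hfin D hN hc hper hcert hℓ₀ ℓ hℓ hcyc ψ hψ hδ)

/-- **`BSD(E,p)` on a rank-one Tamagawa row from the mod-`p^e` certificate + ONE Kurihara number
mod `p^{e+1}`**, Cassels–Tate-free: `#Ш(E/ℚ)(p) = 1`, the lane's `#Ш_an = q` with `ord_p q = 0`, GZK,
modularity. Rank one, `hK` explicit; per pair; nothing booked. [cite: Kim2022StructureSelmer, Thm. 1.9 (6) (PDF p. 8)]
[cite: Miller2011LMS, Def. 1.1] -/
theorem bsdp_of_partial_of_plusSymbolLevelLowersModAt_levelSucc_of_shaAn_unit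
    (hK : KimRankOnePartialAt W p) (hp2 : p ≠ 2)
    (hGZK : rank_eq_analyticRank_of_analyticRank_le_one) (hmod : hasEntireLFunction_rat)
    (hsurj : W.HasSurjectiveModNGaloisRep p)
    (htower : ∀ n : ℕ, W.HasSurjectiveModNGaloisRep (p ^ n : ℕ)) (hr : W.analyticRank = 1)
    {N : ℕ} [NeZero N] (D : ModularParametrizationData W N) (hN : W.conductorNorm ℤ = N)
    (hc : ¬ (p : ℤ) ∣ D.maninConstant)
    (hper : ∃ u : ℚ, ‖(u : ℚ_[p])‖ = 1 ∧ W.realPeriodRat = u * plusPeriod D.f)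
    {e ℓ₀ : ℕ} (hcert : PlusSymbolLevelLowersModAt W p D.f (p ^ e) ℓ₀) (hℓ₀ : ℓ₀ ∣ W.conductorNorm ℤ)
    (ℓ : ℕ) [Fact ℓ.Prime] (hℓ : Kato.IsKolyvaginPrime W p (e + 1) ℓ)
    (hcyc : Nat.card {P : ((WeierstrassCurve.integralModelInt W).map
        (Int.castRingHom (ZMod ℓ))).toAffine.Point // p • P = 0} ≤ p)
    (ψ : (ℓ' : ℕ) → (ZMod ℓ')ˣ →* Multiplicative (ZMod (p ^ (e + 1))))
    (hψ : Function.Surjective (ψ ℓ)) (hδ : kuriharaNumber D.f (p ^ (e + 1)) ℓ ψ ≠ 0)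
    {q : ℚ} (hq : shaAn W = (q : ℂ)) (hv : padicValRat p q = 0) : BSDp W p := by
  have hL : W.entireLFunction 1 = 0 := by
    by_contra hne
    have h0 := (W.analyticRank_eq_zero_iff_holds (hmod W)).mpr hne
    omega
  obtain ⟨hmw, hfin⟩ := hGZK W (by rw [hr])
  have hcard := card_primaryComponent_eq_one_of_partial_of_plusSymbolLevelLowersModAt_levelSucc W p hK
    hp2 hsurj htower hL hr hfin D hN hc hper hcert hℓ₀ ℓ hℓ hcyc ψ hψ hδ
  exact (bsdp_iff_padicValRat_eq_zero_of_card_primaryComponent_eq_one W p hmw hfin hcard hq).mpr hv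

/-- **`p ≥ 5`, level `e + 1`, Cassels–Tate-free, PUBLISHED inputs + the mod-`p^e` certificate**: E73
(`hE73`), `ρ̄_{E,p}` + tower onto, `r_an = 1`, conductor-level datum `D` with `p ∤ c_D` + period
transfer, the certificate at `ℓ₀ ∣ N_E`, ONE `δ̃_ℓ ≢ 0 (mod p^{e+1})` at a cyclic `ℓ ∈ 𝒫_{e+1}`,
`#Ш_an` a `p`-unit ⟹ `BSD(E,p)`. The O7 ∩ X4 Tamagawa rows with `ord_p c_{ℓ₀} = e ≥ 2` (gen 22's
level-THREE route needed Cassels–Tate and reached `ord_p ∏c = 2`; here level `e + 1` is CT-free).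
ANY reduction at `p`; per pair; nothing booked. [cite: Kim2022StructureSelmer, Thm. 1.9 (6) (PDF p. 8)]
[cite: Miller2011LMS, Def. 1.1] -/
theorem bsdp_of_plusSymbolLevelLowersModAt_levelSucc_rankOne_of_shaAn_unit_of_five_le
    (hE73 : Kim2026.kuriharaPartial_vanishingOrder_eq_padicValNat_sha_add_partialInfty_of_maninConstant)
    (hGZK : rank_eq_analyticRank_of_analyticRank_le_one) (hmod : hasEntireLFunction_rat)
    (hp : 5 ≤ p) (hsurj : W.HasSurjectiveModNGaloisRep p)
    (htower : ∀ n : ℕ, W.HasSurjectiveModNGaloisRep (p ^ n : ℕ)) (hr : W.analyticRank = 1)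
    {N : ℕ} [NeZero N] (D : ModularParametrizationData W N) (hN : W.conductorNorm ℤ = N)
    (hc : ¬ (p : ℤ) ∣ D.maninConstant)
    (hper : ∃ u : ℚ, ‖(u : ℚ_[p])‖ = 1 ∧ W.realPeriodRat = u * plusPeriod D.f)
    {e ℓ₀ : ℕ} (hcert : PlusSymbolLevelLowersModAt W p D.f (p ^ e) ℓ₀) (hℓ₀ : ℓ₀ ∣ W.conductorNorm ℤ)
    (ℓ : ℕ) [Fact ℓ.Prime] (hℓ : Kato.IsKolyvaginPrime W p (e + 1) ℓ)
    (hcyc : Nat.card {P : ((WeierstrassCurve.integralModelInt W).map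
        (Int.castRingHom (ZMod ℓ))).toAffine.Point // p • P = 0} ≤ p)
    (ψ : (ℓ' : ℕ) → (ZMod ℓ')ˣ →* Multiplicative (ZMod (p ^ (e + 1))))
    (hψ : Function.Surjective (ψ ℓ)) (hδ : kuriharaNumber D.f (p ^ (e + 1)) ℓ ψ ≠ 0)
    {q : ℚ} (hq : shaAn W = (q : ℂ)) (hv : padicValRat p q = 0) : BSDp W p :=
  bsdp_of_partial_of_plusSymbolLevelLowersModAt_levelSucc_of_shaAn_unit W p
    (kimRankOnePartialAt_of_kim2026_of_five_le W p hE73 hp) (by omega) hGZK hmod hsurj htower hr D hN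
    hc hper hcert hℓ₀ ℓ hℓ hcyc ψ hψ hδ hq hv

/-- **Level `e + 2` + Cassels–Tate** (the BULK of the rank-one Tamagawa rows: `ord_p c_{ℓ₀} = e` at the
certified prime and ONE further unit of `p` elsewhere in `∏_v c_v`, where Conj. 1.10 predicts
`∂^{(1)} = ∂^{(∞)} = e + 1`): under the mod-`p^e` certificate, ONE `δ̃_ℓ ≢ 0 (mod p^{e+2})` at a cyclic
`ℓ ∈ 𝒫_{e+2}` gives `ord_p #Ш(p) ≤ 1`, and the squareness of `#Ш` (`hCT`) forces `ord_p #Ш = 0`. Rank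
one, `hK` explicit; per pair. [cite: Kim2022StructureSelmer, Thm. 1.9 (6) and Conj. 1.10 (PDF p. 8)]
[cite: SilvermanAEC2009, Thm. X.4.14] -/
theorem padicValNat_shaOrder_eq_zero_of_partial_of_plusSymbolLevelLowersModAt_levelSuccSucc_of_casselsTate
    (hK : KimRankOnePartialAt W p) (hp2 : p ≠ 2) (hCT : exists_casselsTate_pairing (K := ℚ))
    (hGZK : rank_eq_analyticRank_of_analyticRank_le_one) (hmod : hasEntireLFunction_rat)
    (hsurj : W.HasSurjectiveModNGaloisRep p)
    (htower : ∀ n : ℕ, W.HasSurjectiveModNGaloisRep (p ^ n : ℕ)) (hr : W.analyticRank = 1)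
    {N : ℕ} [NeZero N] (D : ModularParametrizationData W N) (hN : W.conductorNorm ℤ = N)
    (hc : ¬ (p : ℤ) ∣ D.maninConstant)
    (hper : ∃ u : ℚ, ‖(u : ℚ_[p])‖ = 1 ∧ W.realPeriodRat = u * plusPeriod D.f)
    {e ℓ₀ : ℕ} (hcert : PlusSymbolLevelLowersModAt W p D.f (p ^ e) ℓ₀) (hℓ₀ : ℓ₀ ∣ W.conductorNorm ℤ)
    (ℓ : ℕ) [Fact ℓ.Prime] (hℓ : Kato.IsKolyvaginPrime W p (e + 2) ℓ)
    (hcyc : Nat.card {P : ((WeierstrassCurve.integralModelInt W).map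
        (Int.castRingHom (ZMod ℓ))).toAffine.Point // p • P = 0} ≤ p)
    (ψ : (ℓ' : ℕ) → (ZMod ℓ')ˣ →* Multiplicative (ZMod (p ^ (e + 2))))
    (hψ : Function.Surjective (ψ ℓ)) (hδ : kuriharaNumber D.f (p ^ (e + 2)) ℓ ψ ≠ 0) :
    padicValNat p W.shaOrder = 0 := by
  have hr1 : W.analyticRank ≤ 1 := by rw [hr]
  have hL : W.entireLFunction 1 = 0 := by
    by_contra hne
    have h0 := (W.analyticRank_eq_zero_iff_holds (hmod W)).mpr hne
    omega
  have hfin : W.ShaFinite := (hGZK W hr1).2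
  haveI : Finite W.sha := hfin
  have h := padicValNat_primaryComponent_add_le_of_partial_of_plusSymbolLevelLowersModAt W p hK hp2
    hsurj htower hL hr hfin D hN hc hper hcert hℓ₀ (by omega) ℓ hℓ hcyc ψ hψ hδ
  have hle : padicValNat p (Nat.card (AddCommGroup.primaryComponent W.sha p)) ≤ 1 := by omega
  rw [padicValNat_card_addPrimaryComponent p] at hle
  have hsq : IsSquare W.shaOrder := isSquare_shaOrder_of_casselsTate hCT W hfin
  have hn : W.shaOrder ≠ 0 := (WeierstrassCurve.shaOrder_pos W hfin).ne'
  by_contra h0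
  have hdvd : p ∣ W.shaOrder := by
    by_contra hnd
    exact h0 (padicValNat.eq_zero_of_not_dvd hnd)
  have h2 : 2 ≤ padicValNat p W.shaOrder := two_le_padicValNat_of_isSquare_of_dvd hsq hn hdvd
  have : padicValNat p W.shaOrder ≤ 1 := by
    unfold WeierstrassCurve.shaOrder; exact hle
  omega

/-- **`BSD(E,p)` at level `e + 2` + Cassels–Tate** on a rank-one row with the mod-`p^e` certificate,
`#Ш_an = q`, `ord_p q = 0` (`Typed.bsdp_of_shaAn_unit_of_noPTorsion`, GZK). Rank one, `hK` explicit;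
per pair; nothing booked. [cite: Kim2022StructureSelmer, Thm. 1.9 (6) (PDF p. 8)] [cite: SilvermanAEC2009, Thm. X.4.14]
[cite: Miller2011LMS, Def. 1.1] -/
theorem bsdp_of_partial_of_plusSymbolLevelLowersModAt_levelSuccSucc_of_casselsTate_of_shaAn_unit
    (hK : KimRankOnePartialAt W p) (hp2 : p ≠ 2) (hCT : exists_casselsTate_pairing (K := ℚ))
    (hGZK : rank_eq_analyticRank_of_analyticRank_le_one) (hmod : hasEntireLFunction_rat)
    (hsurj : W.HasSurjectiveModNGaloisRep p)
    (htower : ∀ n : ℕ, W.HasSurjectiveModNGaloisRep (p ^ n : ℕ)) (hr : W.analyticRank = 1)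
    {N : ℕ} [NeZero N] (D : ModularParametrizationData W N) (hN : W.conductorNorm ℤ = N)
    (hc : ¬ (p : ℤ) ∣ D.maninConstant)
    (hper : ∃ u : ℚ, ‖(u : ℚ_[p])‖ = 1 ∧ W.realPeriodRat = u * plusPeriod D.f)
    {e ℓ₀ : ℕ} (hcert : PlusSymbolLevelLowersModAt W p D.f (p ^ e) ℓ₀) (hℓ₀ : ℓ₀ ∣ W.conductorNorm ℤ)
    (ℓ : ℕ) [Fact ℓ.Prime] (hℓ : Kato.IsKolyvaginPrime W p (e + 2) ℓ)
    (hcyc : Nat.card {P : ((WeierstrassCurve.integralModelInt W).map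
        (Int.castRingHom (ZMod ℓ))).toAffine.Point // p • P = 0} ≤ p)
    (ψ : (ℓ' : ℕ) → (ZMod ℓ')ˣ →* Multiplicative (ZMod (p ^ (e + 2))))
    (hψ : Function.Surjective (ψ ℓ)) (hδ : kuriharaNumber D.f (p ^ (e + 2)) ℓ ψ ≠ 0)
    {q : ℚ} (hq : shaAn W = (q : ℂ)) (hv : padicValRat p q = 0) : BSDp W p := by
  have hr1 : W.analyticRank ≤ 1 := by rw [hr]
  have hfin : W.ShaFinite := (hGZK W hr1).2
  have h0 := padicValNat_shaOrder_eq_zero_of_partial_of_plusSymbolLevelLowersModAt_levelSuccSucc_of_casselsTate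
    W p hK hp2 hCT hGZK hmod hsurj htower hr D hN hc hper hcert hℓ₀ ℓ hℓ hcyc ψ hψ hδ
  have hn : W.shaOrder ≠ 0 := (WeierstrassCurve.shaOrder_pos W hfin).ne'
  have hnd : ¬ p ∣ W.shaOrder := by
    intro hdvd
    have := (padicValNat_dvd_iff_le hn).1 (by simpa using hdvd : p ^ 1 ∣ W.shaOrder)
    omega
  refine bsdp_of_shaAn_unit_of_noPTorsion W p hGZK hr1 hq hv ?_
  intro x hx
  by_contra hx0
  refine hnd (dvd_shaOrder_of_exists_torsion W p ⟨x, hx0, ?_⟩)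
  rw [← natCast_zsmul]
  exact hx

/-- **`p ≥ 5`, level `e + 2` + Cassels–Tate, PUBLISHED inputs + the mod-`p^e` certificate** (the rows
with `ord_p ∏c = e + 1`, `ord_p c_{ℓ₀} = e`): E73, CT, GZK, modularity, the certificate, ONE
`δ̃_ℓ ≢ 0 (mod p^{e+2})` at a cyclic `ℓ ∈ 𝒫_{e+2}`, `#Ш_an` a `p`-unit ⟹ `BSD(E,p)`. Per pair; nothing
booked. [cite: Kim2022StructureSelmer, Thm. 1.9 (6) (PDF p. 8)] [cite: SilvermanAEC2009, Thm. X.4.14]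
[cite: Miller2011LMS, Def. 1.1] -/
theorem bsdp_of_plusSymbolLevelLowersModAt_levelSuccSucc_rankOne_of_casselsTate_of_shaAn_unit_of_five_le
    (hE73 : Kim2026.kuriharaPartial_vanishingOrder_eq_padicValNat_sha_add_partialInfty_of_maninConstant)
    (hCT : exists_casselsTate_pairing (K := ℚ))
    (hGZK : rank_eq_analyticRank_of_analyticRank_le_one) (hmod : hasEntireLFunction_rat)
    (hp : 5 ≤ p) (hsurj : W.HasSurjectiveModNGaloisRep p)
    (htower : ∀ n : ℕ, W.HasSurjectiveModNGaloisRep (p ^ n : ℕ)) (hr : W.analyticRank = 1)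
    {N : ℕ} [NeZero N] (D : ModularParametrizationData W N) (hN : W.conductorNorm ℤ = N)
    (hc : ¬ (p : ℤ) ∣ D.maninConstant)
    (hper : ∃ u : ℚ, ‖(u : ℚ_[p])‖ = 1 ∧ W.realPeriodRat = u * plusPeriod D.f)
    {e ℓ₀ : ℕ} (hcert : PlusSymbolLevelLowersModAt W p D.f (p ^ e) ℓ₀) (hℓ₀ : ℓ₀ ∣ W.conductorNorm ℤ)
    (ℓ : ℕ) [Fact ℓ.Prime] (hℓ : Kato.IsKolyvaginPrime W p (e + 2) ℓ)
    (hcyc : Nat.card {P : ((WeierstrassCurve.integralModelInt W).map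
        (Int.castRingHom (ZMod ℓ))).toAffine.Point // p • P = 0} ≤ p)
    (ψ : (ℓ' : ℕ) → (ZMod ℓ')ˣ →* Multiplicative (ZMod (p ^ (e + 2))))
    (hψ : Function.Surjective (ψ ℓ)) (hδ : kuriharaNumber D.f (p ^ (e + 2)) ℓ ψ ≠ 0)
    {q : ℚ} (hq : shaAn W = (q : ℂ)) (hv : padicValRat p q = 0) : BSDp W p :=
  bsdp_of_partial_of_plusSymbolLevelLowersModAt_levelSuccSucc_of_casselsTate_of_shaAn_unit W p
    (kimRankOnePartialAt_of_kim2026_of_five_le W p hE73 hp) (by omega) hCT hGZK hmod hsurj htower hr D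
    hN hc hper hcert hℓ₀ ℓ hℓ hcyc ψ hψ hδ hq hv

/-- **`p ≥ 5`, the general level under a mod-`p^e` certificate** (PUBLISHED inputs + certificates): E73,
the certificate and ONE `δ̃_ℓ ≢ 0 (mod p^k)` at a cyclic `ℓ ∈ 𝒫_k` give `ord_p #Ш(E/ℚ)(p) ≤ k − 1 − e`.
ANY reduction at `p`; per pair. [cite: Kim2022StructureSelmer, Thm. 1.9 (6) and §1.5.1 (PDF pp. 7–8)] -/
theorem padicValNat_primaryComponent_le_sub_of_plusSymbolLevelLowersModAt_rankOne_of_five_le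
    (hE73 : Kim2026.kuriharaPartial_vanishingOrder_eq_padicValNat_sha_add_partialInfty_of_maninConstant)
    (hp : 5 ≤ p) (hsurj : W.HasSurjectiveModNGaloisRep p)
    (htower : ∀ n : ℕ, W.HasSurjectiveModNGaloisRep (p ^ n : ℕ)) (hL : W.entireLFunction 1 = 0)
    (hr : W.analyticRank = 1) (hfin : Finite W.sha)
    {N : ℕ} [NeZero N] (D : ModularParametrizationData W N) (hN : W.conductorNorm ℤ = N)
    (hc : ¬ (p : ℤ) ∣ D.maninConstant)
    (hper : ∃ u : ℚ, ‖(u : ℚ_[p])‖ = 1 ∧ W.realPeriodRat = u * plusPeriod D.f)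
    {e ℓ₀ : ℕ} (hcert : PlusSymbolLevelLowersModAt W p D.f (p ^ e) ℓ₀) (hℓ₀ : ℓ₀ ∣ W.conductorNorm ℤ)
    {k : ℕ} (hk : 1 ≤ k) (ℓ : ℕ) [Fact ℓ.Prime] (hℓ : Kato.IsKolyvaginPrime W p k ℓ)
    (hcyc : Nat.card {P : ((WeierstrassCurve.integralModelInt W).map
        (Int.castRingHom (ZMod ℓ))).toAffine.Point // p • P = 0} ≤ p)
    (ψ : (ℓ' : ℕ) → (ZMod ℓ')ˣ →* Multiplicative (ZMod (p ^ k)))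
    (hψ : Function.Surjective (ψ ℓ)) (hδ : kuriharaNumber D.f (p ^ k) ℓ ψ ≠ 0) :
    padicValNat p (Nat.card (AddCommGroup.primaryComponent W.sha p)) ≤ k - 1 - e := by
  have h := padicValNat_primaryComponent_add_le_of_partial_of_plusSymbolLevelLowersModAt W p
    (kimRankOnePartialAt_of_kim2026_of_five_le W p hE73 hp) (by omega) hsurj htower hL hr hfin D hN
    hc hper hcert hℓ₀ hk ℓ hℓ hcyc ψ hψ hδ
  omega


end RankOne

/-! ### §2 `p = 3`, rank ONE: MODULO the cell's conjecture `X4SharpThreeKimRankOnePartial` -/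

section Three

variable (W : WeierstrassCurve ℚ) [W.IsElliptic] [W.IsGloballyMinimal]

/-- **O7 ∩ X4@3, Tamagawa row with `ord₃ c_{ℓ₀} = e`, mod-`3^e` certificate + level `e + 1`,
Cassels–Tate-free, MODULO the conjecture** `X4SharpThreeKimRankOnePartial` (`h3`, p17; printed reason
Kim 2025 Thm. 1.1 (Str), PREPRINT): on `ClassX4 W 3` ∧ `r_an = 1` with surj(3) and a tower
certificate, a conductor-level datum `D` with `3 ∤ c_D` and period transfer, the mod-`3^e`
level-lowering certificate at some `ℓ₀ ∣ N_E`, ONE `δ̃_ℓ ≢ 0 (mod 3^{e+1})` at a cyclic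
`ℓ ∈ 𝒫_{e+1}(E,3)` and `#Ш_an = q` a `3`-unit: `BSD(E,3)`. Per pair; NOT a class theorem; nothing
booked. [cite: Kim2022StructureSelmer, Thm. 1.9 (6) (PDF p. 8)]
[cite: Kim2025RefinedTNC, Thm. 1.1 (Str) (PDF p. 4; ANNOUNCED preprint — the reason, not a source of truth)]
[cite: Miller2011LMS, Def. 1.1] -/
theorem X4RankOne.bsdp_three_of_partial_of_plusSymbolLevelLowersModAt_levelSucc
    (h3 : X4SharpThreeKimRankOnePartial)
    (hGZK : rank_eq_analyticRank_of_analyticRank_le_one) (hmod : hasEntireLFunction_rat)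
    (hX : ClassX4 W 3) (hsurj : W.HasSurjectiveModNGaloisRep 3)
    (htower : ∀ n : ℕ, W.HasSurjectiveModNGaloisRep (3 ^ n : ℕ)) (hr : W.analyticRank = 1)
    {N : ℕ} [NeZero N] (D : ModularParametrizationData W N) (hN : W.conductorNorm ℤ = N)
    (hc : ¬ (3 : ℤ) ∣ D.maninConstant)
    (hper : ∃ u : ℚ, ‖(u : ℚ_[3])‖ = 1 ∧ W.realPeriodRat = u * plusPeriod D.f)
    {e ℓ₀ : ℕ} (hcert : PlusSymbolLevelLowersModAt W 3 D.f (3 ^ e) ℓ₀) (hℓ₀ : ℓ₀ ∣ W.conductorNorm ℤ)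
    (ℓ : ℕ) [Fact ℓ.Prime] (hℓ : Kato.IsKolyvaginPrime W 3 (e + 1) ℓ)
    (hcyc : Nat.card {P : ((WeierstrassCurve.integralModelInt W).map
        (Int.castRingHom (ZMod ℓ))).toAffine.Point // 3 • P = 0} ≤ 3)
    (ψ : (ℓ' : ℕ) → (ZMod ℓ')ˣ →* Multiplicative (ZMod (3 ^ (e + 1))))
    (hψ : Function.Surjective (ψ ℓ)) (hδ : kuriharaNumber D.f (3 ^ (e + 1)) ℓ ψ ≠ 0)
    {q : ℚ} (hq : shaAn W = (q : ℂ)) (hv : padicValRat 3 q = 0) : BSDp W 3 :=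
  bsdp_of_partial_of_plusSymbolLevelLowersModAt_levelSucc_of_shaAn_unit W 3
    (kimRankOnePartialAt_three_of_classX4 W h3 hX) (by norm_num) hGZK hmod hsurj htower hr D hN hc
    hper hcert hℓ₀ ℓ hℓ hcyc ψ hψ hδ hq hv

/-- **O7 ∩ X4@3, mod-`3^e` certificate + level `e + 2` + Cassels–Tate, MODULO the conjecture** (the
`ord₃ ∏c = e + 1` rows): ONE `δ̃_ℓ ≢ 0 (mod 3^{e+2})` at a cyclic `ℓ ∈ 𝒫_{e+2}(E,3)` and `hCT`. Per pair;
nothing booked. [cite: Kim2025RefinedTNC, Thm. 1.1 (Str) (PDF p. 4; ANNOUNCED preprint — the reason, not a source of truth)]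
[cite: Kim2022StructureSelmer, Thm. 1.9 (6) (PDF p. 8)] [cite: SilvermanAEC2009, Thm. X.4.14] -/
theorem X4RankOne.bsdp_three_of_partial_of_plusSymbolLevelLowersModAt_levelSuccSucc_of_casselsTate
    (h3 : X4SharpThreeKimRankOnePartial) (hCT : exists_casselsTate_pairing (K := ℚ))
    (hGZK : rank_eq_analyticRank_of_analyticRank_le_one) (hmod : hasEntireLFunction_rat)
    (hX : ClassX4 W 3) (hsurj : W.HasSurjectiveModNGaloisRep 3)
    (htower : ∀ n : ℕ, W.HasSurjectiveModNGaloisRep (3 ^ n : ℕ)) (hr : W.analyticRank = 1)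
    {N : ℕ} [NeZero N] (D : ModularParametrizationData W N) (hN : W.conductorNorm ℤ = N)
    (hc : ¬ (3 : ℤ) ∣ D.maninConstant)
    (hper : ∃ u : ℚ, ‖(u : ℚ_[3])‖ = 1 ∧ W.realPeriodRat = u * plusPeriod D.f)
    {e ℓ₀ : ℕ} (hcert : PlusSymbolLevelLowersModAt W 3 D.f (3 ^ e) ℓ₀) (hℓ₀ : ℓ₀ ∣ W.conductorNorm ℤ)
    (ℓ : ℕ) [Fact ℓ.Prime] (hℓ : Kato.IsKolyvaginPrime W 3 (e + 2) ℓ)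
    (hcyc : Nat.card {P : ((WeierstrassCurve.integralModelInt W).map
        (Int.castRingHom (ZMod ℓ))).toAffine.Point // 3 • P = 0} ≤ 3)
    (ψ : (ℓ' : ℕ) → (ZMod ℓ')ˣ →* Multiplicative (ZMod (3 ^ (e + 2))))
    (hψ : Function.Surjective (ψ ℓ)) (hδ : kuriharaNumber D.f (3 ^ (e + 2)) ℓ ψ ≠ 0)
    {q : ℚ} (hq : shaAn W = (q : ℂ)) (hv : padicValRat 3 q = 0) : BSDp W 3 :=
  bsdp_of_partial_of_plusSymbolLevelLowersModAt_levelSuccSucc_of_casselsTate_of_shaAn_unit W 3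
    (kimRankOnePartialAt_three_of_classX4 W h3 hX) (by norm_num) hCT hGZK hmod hsurj htower hr D hN
    hc hper hcert hℓ₀ ℓ hℓ hcyc ψ hψ hδ hq hv


end Three

end Summit.BirchSwinnertonDyer.Rank1Residual.X4

end
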